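import Summits.QuantumFields.YangMills.Theorems.BalabanUVNodesN15KingModelTorusPlaneWaves
import Summits.QuantumFields.YangMills.Theorems.BalabanUVNodesN15KingModelHeatKernelCycle
import HarnessLib

/-!
# BalabanUVNodes ∕ N15 — THE KING-MODEL RUNG (PART Ϣ-f): HEAT-KERNEL SUBORDINATION OF KING's TORUS COVARIANCE —
# `(lapF K c m²)⁻¹(x,y) = Re ∫₀^∞ e^{−tm²}·Π_μ Q^{(K_μ)}_{ct}((x−y)_μ) dt` and `c·|(lapF K c m²)⁻¹(x,y)| ≤ ∫₀^∞ e^{−(m²∕c)s}·Π_μ‖Q^{(K_μ)}_s((x−y)_μ)‖ ds` (every torus `Π_μℤ∕K_μ`, `c > 0`, `m² > 0`)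
# (Track A, DAG node N15 = NE2; FAN-OUT v1.1 §N15 s3 «KING-MODEL RUNG … + what the curved case adds»; count-neutral)

HONEST FRAMING.  Count-neutral (cell `pub-ymgap`, seat `pub-ymgap-dag-n15-e` g55; `--supports stmt-QuantumFields-27247 --as helper` = K3ᴬ).  King's `A = 0` covariance `(c(−Δ)+m²)⁻¹` on the torus
`Ω = Π_μℤ∕K_μ` ((2.13) p.653 with `c = L²`; symbol (4.4) p.670) in King's plane waves is Ε-e `lapF_inv_eq_kingPlaneWave`: `(lapF)⁻¹(x,y) = |Ω|⁻¹Σ_q lapSym(q)⁻¹χ_q(x−y)`.  THIS FILE: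
(i) SUBORDINATION `lapSym(q)⁻¹ = ∫₀^∞e^{−t·lapSym(q)}dt` (`lapSym ≥ m² > 0`; the one-line `∫₀^∞e^{−tw}dt = w⁻¹` is the tree's `LaceExpansionGaussianHeatKernel.integral_exp_neg_mul_Ioi` [Hara 2008 (2.1)],
re-derived here for `w = lapSym(q)` to keep the lace-expansion tower out of the imports); (ii) FACTORISATION of the plane-wave sum of the heat symbol over the product torus:
★★ **`card_inv_sum_exp_lapSym_chi`** — `|Ω|⁻¹Σ_q e^{−t·lapSym(q)}χ_q(z) = e^{−tm²}·Π_μ Q^{(K_μ)}_{ct}(z_μ)` (`lapSym = m² + cΣ_μ(2−2cos p′_μ)`, `χ_q = Π_μψ(q_μz_μ)`, `|Ω| = Π_μK_μ`, `Σ_qΠ_μ = Π_μΣ_k`;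
`Q` = PART Ϣ-d's `cycleHeat`); (iii) the finite sum through the integral: ★★★ **`kingPlaneWave_eq_integral`** (`(lapF)⁻¹(x,y) = ∫_{(0,∞)} e^{−tm²}Π_μQ_{ct}((x−y)_μ)dt` as a complex Bochner
integral), ★★★ **`abs_lapF_inv_le_integral`** (`|(lapF)⁻¹(x,y)| ≤ ∫_{(0,∞)}e^{−tm²}Π_μ‖Q_{ct}((x−y)_μ)‖dt`) and, substituting `s = ct`, ★★★★ **`mul_abs_lapF_inv_le_integral`**
(`c·|(lapF K c m²)⁻¹(x,y)| ≤ ∫_{(0,∞)}e^{−(m²∕c)s}Π_μ‖Q^{(K_μ)}_s((x−y)_μ)‖ds`) with the integrability of the majorant (`integrableOn_heatMajorant`) — the form PART Ϣ-g integrates on the cubic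
four-torus (the mass enters ONLY through `e^{−(m²∕c)s}`; every other bound of PART Ϣ is mass-free — that is the η-uniformity at `c = L²`).  NOT Bałaban's (3.42); NOT a node discharge;
nothing continuum ∕ ℝ⁴ ∕ OS ∕ Clay.
PRIOR TREE ART (by name): Ε-e `TorusPlaneWaves` (`kingPlaneWave`, `lapF_inv_eq_kingPlaneWave`), `King1986.EffectiveLaplacianSymbol` (`lapF`, `lapSym`, `lapSym_ge`), `B5Prop11Plancherel`
(`Tor`, `chi`, `sOf`), PART Ϣ-d (`cycleHeat`, `cycAngle`, `norm_cycleHeat_le_one`, `continuous_cycleHeat`); Mathlib `integral_comp_mul_left_Ioi`, `integral_exp_neg_Ioi`, `exp_neg_integrableOn_Ioi`,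
`integral_finsetSum`, `integral_complex_ofReal`, `norm_integral_le_integral_norm`, `Fintype.prod_sum`; the tree's `LaceExpansionGaussianHeatKernel.haraC_eq_integral_haraI` is the
same subordination on `ℤ^d` with a Fourier INTEGRAL (Hara 2008 (2.1)) — here the torus sum is finite and no Fubini is needed.
Dedup (rg at filing): basename 0 files; needles `inv_lapSym_eq_integral|card_inv_sum_exp_lapSym_chi|kingPlaneWave_eq_integral|abs_lapF_inv_le_integral|mul_abs_lapF_inv_le_integral|integrableOn_heatMajorant` 0 tree files.
Locators: [King1986] (2.13) p.653, (4.4) p.670, (4.35) p.674; [Balaban1984PropagatorsI] (1.29) p.23; [Hara2008] §2.1 (2.1)–(2.2) (the subordination device); [LawlerLimic2010] §2.3.  0 `sorry`, 0 `def`.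
-/

noncomputable section

open Real Set Finset Complex MeasureTheory
open scoped BigOperators

namespace Summit.QuantumFields.YangMills.BalabanUVNodes.N15KingModelRung.HeatKernel

open Literature.MathematicalPhysics.QuantumFieldTheory.Balaban1983to89.B5Prop11Plancherel (Tor chi sOf)
open Literature.MathematicalPhysics.QuantumFieldTheory.King1986.Torus (lapF lapSym lapSym_ge)
open Summit.QuantumFields.YangMills.BalabanUVNodes.N15KingModelRung.TorusSpectral (kingPlaneWave lapF_inv_eq_kingPlaneWave)

variable {d : ℕ} (K : Fin (d + 1) → ℕ) [hK : ∀ μ, NeZero (K μ)] {c m2 : ℝ}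

/-! ## §1 Subordination `lapSym⁻¹ = ∫₀^∞ e^{−t·lapSym} dt` -/

omit hK in
/-- `∫₀^∞ e^{−tw}dt = w⁻¹` for `w > 0` (Mathlib `integral_exp_neg_Ioi` rescaled; the tree's `LaceExpansionGaussianHeatKernel.integral_exp_neg_mul_Ioi`, not imported). [cite: Hara2008, §2.1 (2.1)] -/
theorem integral_exp_neg_mul_Ioi_eq_inv {w : ℝ} (hw : 0 < w) : ∫ t in Ioi (0 : ℝ), Real.exp (-(t * w)) = w⁻¹ := by
  have h := integral_comp_mul_left_Ioi (fun s => Real.exp (-s)) 0 hw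
  simp only [mul_zero] at h
  rw [integral_exp_neg_Ioi 0, neg_zero, Real.exp_zero, smul_eq_mul, mul_one] at h
  rw [← h]
  refine integral_congr_ae (Filter.Eventually.of_forall fun t => ?_)
  simp [mul_comm]

omit hK in
/-- ★ SUBORDINATION FOR THE SYMBOL: `lapSym(q)⁻¹ = ∫₀^∞ e^{−t·lapSym(q)}dt` (`c ≥ 0`, `m² > 0`, so `lapSym ≥ m² > 0`). [cite: King1986, (4.4) p.670; Hara2008, §2.1 (2.1)] -/
theorem inv_lapSym_eq_integral (hc : 0 ≤ c) (hm : 0 < m2) (q : Tor K) :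
    (lapSym K c m2 q)⁻¹ = ∫ t in Ioi (0 : ℝ), Real.exp (-(t * lapSym K c m2 q)) :=
  (integral_exp_neg_mul_Ioi_eq_inv (lt_of_lt_of_le hm (lapSym_ge K c m2 hc q))).symm

/-! ## §2 Factorisation of the heat symbol over the product torus -/

/-- `|Π_μℤ∕K_μ| = Π_μK_μ`. [folklore] -/
theorem card_tor_eq_prod : (Fintype.card (Tor K) : ℂ) = ∏ μ : Fin (d + 1), ((K μ : ℕ) : ℂ) := by
  rw [Fintype.card_pi]; push_cast; exact Finset.prod_congr rfl fun μ _ => by rw [ZMod.card]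

omit hK in
/-- The reduced momentum of `B5Prop11Plancherel.sOf` is PART Ϣ-d's `cycAngle`, coordinate by coordinate. [cite: King1986, (4.4) p.670] -/
theorem sOf_eq_cycAngle (q : Tor K) (μ : Fin (d + 1)) : sOf K q μ = cycAngle (K μ) (q μ) := rfl

omit hK in
/-- `e^{−t·lapSym(q)} = e^{−tm²}·Π_μ e^{−tc(2−2cos θ_{q_μ})}`. [cite: King1986, (4.4) p.670] -/
theorem exp_neg_mul_lapSym (t : ℝ) (q : Tor K) :
    Real.exp (-(t * lapSym K c m2 q)) = Real.exp (-(t * m2)) * ∏ μ : Fin (d + 1), Real.exp (-(t * c * (2 - 2 * Real.cos (cycAngle (K μ) (q μ))))) := by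
  unfold lapSym
  rw [← Real.exp_sum, ← Real.exp_add]
  congr 1
  rw [Finset.mul_sum]
  simp only [sOf_eq_cycAngle]
  rw [show -(t * (m2 + ∑ μ : Fin (d + 1), c * (2 - 2 * Real.cos (cycAngle (K μ) (q μ))))) =
      -(t * m2) + -(t * ∑ μ : Fin (d + 1), c * (2 - 2 * Real.cos (cycAngle (K μ) (q μ)))) by ring]
  congr 1
  rw [Finset.mul_sum, ← Finset.sum_neg_distrib]
  exact Finset.sum_congr rfl fun μ _ => by ring

/-- ★★ **FACTORISATION**: `|Ω|⁻¹Σ_q e^{−t·lapSym(q)}·χ_q(z) = e^{−tm²}·Π_μ Q^{(K_μ)}_{ct}(z_μ)` — the plane-wave sum of the heat symbol on the product torus is the product of the cycle heat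
kernels (`χ_q(z) = Π_μψ(q_μz_μ)`, `|Ω| = Π_μK_μ`, `Σ_qΠ_μ = Π_μΣ_k`). [cite: King1986, (4.4) p.670, (4.35) p.674; Balaban1984PropagatorsI, (1.29) p.23] -/
theorem card_inv_sum_exp_lapSym_chi (t : ℝ) (z : Tor K) :
    (Fintype.card (Tor K) : ℂ)⁻¹ * ∑ q : Tor K, ((Real.exp (-(t * lapSym K c m2 q)) : ℝ) : ℂ) * chi K q z
      = ((Real.exp (-(t * m2)) : ℝ) : ℂ) * ∏ μ : Fin (d + 1), cycleHeat (K μ) (t * c) (z μ) := by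
  classical
  -- each summand is a product over coordinates
  have hterm : ∀ q : Tor K, ((Real.exp (-(t * lapSym K c m2 q)) : ℝ) : ℂ) * chi K q z
      = ((Real.exp (-(t * m2)) : ℝ) : ℂ) * ∏ μ : Fin (d + 1),
          (((Real.exp (-(t * c * (2 - 2 * Real.cos (cycAngle (K μ) (q μ))))) : ℝ) : ℂ) * ZMod.stdAddChar (q μ * z μ)) := by
    intro q
    rw [exp_neg_mul_lapSym K t q, Complex.ofReal_mul, Complex.ofReal_prod, Finset.prod_mul_distrib, mul_assoc]
    rfl
  simp_rw [hterm]
  rw [← Finset.mul_sum]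
  -- the product of the cycle kernels, expanded with `Π_μΣ_k = Σ_qΠ_μ`
  have hR : ∏ μ : Fin (d + 1), cycleHeat (K μ) (t * c) (z μ)
      = (∏ μ : Fin (d + 1), ((K μ : ℕ) : ℂ)⁻¹) * ∑ q : Tor K, ∏ μ : Fin (d + 1),
          (((Real.exp (-(t * c * (2 - 2 * Real.cos (cycAngle (K μ) (q μ))))) : ℝ) : ℂ) * ZMod.stdAddChar (q μ * z μ)) := by
    unfold cycleHeat
    rw [Finset.prod_mul_distrib, Fintype.prod_sum]
  rw [hR, card_tor_eq_prod K, Finset.prod_inv_distrib]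
  ring

/-! ## §3 The covariance as a time integral; the norm bound; the substitution `s = ct` -/

/-- Integrability of one plane-wave mode of the heat symbol on `(0,∞)`. [folklore] -/
theorem integrableOn_exp_lapSym_chi (hc : 0 ≤ c) (hm : 0 < m2) (q z : Tor K) :
    IntegrableOn (fun t : ℝ => ((Real.exp (-(t * lapSym K c m2 q)) : ℝ) : ℂ) * chi K q z) (Ioi 0) := by
  have hw : 0 < lapSym K c m2 q := lt_of_lt_of_le hm (lapSym_ge K c m2 hc q)
  have h1 : IntegrableOn (fun t : ℝ => Real.exp (-(t * lapSym K c m2 q))) (Ioi 0) := by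
    have := exp_neg_integrableOn_Ioi 0 hw
    refine this.congr_fun (fun t _ => by ring_nf) measurableSet_Ioi
  exact (h1.ofReal).mul_const _

/-- ★★★ **KING's TORUS COVARIANCE AS A HEAT-KERNEL TIME INTEGRAL**: `(lapF K c m²)⁻¹(x,y) = ∫_{(0,∞)} e^{−tm²}·Π_μ Q^{(K_μ)}_{ct}((x−y)_μ) dt` (as complex numbers; `c ≥ 0`, `m² > 0`).
[cite: King1986, (2.13) p.653, (4.4) p.670, (4.35) p.674; Hara2008, §2.1 (2.1)–(2.2)] -/
theorem kingPlaneWave_eq_integral (hc : 0 ≤ c) (hm : 0 < m2) (x y : Tor K) :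
    (((lapF K c m2)⁻¹ x y : ℝ) : ℂ) = ∫ t in Ioi (0 : ℝ), ((Real.exp (-(t * m2)) : ℝ) : ℂ) * ∏ μ : Fin (d + 1), cycleHeat (K μ) (t * c) ((x - y) μ) := by
  rw [lapF_inv_eq_kingPlaneWave K hc hm x y]
  unfold kingPlaneWave
  -- subordination, mode by mode
  have hmode : ∀ q : Tor K, ((((lapSym K c m2 q)⁻¹ : ℝ)) : ℂ) * chi K q (x - y)
      = ∫ t in Ioi (0 : ℝ), ((Real.exp (-(t * lapSym K c m2 q)) : ℝ) : ℂ) * chi K q (x - y) := by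
    intro q
    rw [inv_lapSym_eq_integral K hc hm q, integral_mul_const, integral_complex_ofReal]
  simp_rw [hmode]
  rw [← integral_finsetSum _ (fun q _ => integrableOn_exp_lapSym_chi K hc hm q (x - y)), ← integral_const_mul]
  refine integral_congr_ae (Filter.Eventually.of_forall fun t => ?_)
  exact card_inv_sum_exp_lapSym_chi K t (x - y)

/-- The integrand's norm: `‖e^{−tm²}Π_μQ_{ct}(z_μ)‖ = e^{−tm²}Π_μ‖Q_{ct}(z_μ)‖`. [folklore] -/
theorem norm_heatIntegrand (t : ℝ) (z : Tor K) :
    ‖((Real.exp (-(t * m2)) : ℝ) : ℂ) * ∏ μ : Fin (d + 1), cycleHeat (K μ) (t * c) (z μ)‖ = Real.exp (-(t * m2)) * ∏ μ : Fin (d + 1), ‖cycleHeat (K μ) (t * c) (z μ)‖ := by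
  rw [norm_mul, Complex.norm_real, Real.norm_eq_abs, abs_of_pos (Real.exp_pos _), norm_prod]

/-- Integrability of the subordination integrand on `(0,∞)` (`c ≥ 0`, `m² > 0`: dominated by `e^{−tm²}`, every `‖Q‖ ≤ 1`). [folklore] -/
theorem integrableOn_heatIntegrand (hc : 0 ≤ c) (hm : 0 < m2) (z : Tor K) :
    IntegrableOn (fun t : ℝ => ((Real.exp (-(t * m2)) : ℝ) : ℂ) * ∏ μ : Fin (d + 1), cycleHeat (K μ) (t * c) (z μ)) (Ioi 0) := by
  have hmaj : IntegrableOn (fun t : ℝ => Real.exp (-(t * m2))) (Ioi 0) := by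
    have := exp_neg_integrableOn_Ioi 0 hm
    exact this.congr_fun (fun t _ => by ring_nf) measurableSet_Ioi
  refine Integrable.mono' hmaj ?_ ?_
  · refine Continuous.aestronglyMeasurable ?_
    refine Continuous.mul (Complex.continuous_ofReal.comp (Real.continuous_exp.comp (by fun_prop))) ?_
    exact continuous_finsetProd _ fun μ _ => (continuous_cycleHeat (K := K μ) (z μ)).comp (continuous_id.mul continuous_const)
  · refine (ae_restrict_iff' measurableSet_Ioi).mpr (Filter.Eventually.of_forall fun t ht => ?_)
    rw [norm_heatIntegrand K t z]
    have hprod : ∏ μ : Fin (d + 1), ‖cycleHeat (K μ) (t * c) (z μ)‖ ≤ 1 := by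
      have ht0 : 0 ≤ t * c := mul_nonneg (le_of_lt ht) hc
      calc ∏ μ : Fin (d + 1), ‖cycleHeat (K μ) (t * c) (z μ)‖ ≤ ∏ _μ : Fin (d + 1), (1 : ℝ) :=
            Finset.prod_le_prod (fun μ _ => norm_nonneg _) (fun μ _ => norm_cycleHeat_le_one ht0 (z μ))
        _ = 1 := by simp
    calc Real.exp (-(t * m2)) * ∏ μ : Fin (d + 1), ‖cycleHeat (K μ) (t * c) (z μ)‖ ≤ Real.exp (-(t * m2)) * 1 :=
          mul_le_mul_of_nonneg_left hprod (Real.exp_pos _).le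
      _ = Real.exp (-(t * m2)) := mul_one _

/-- ★★★ **THE NORM BOUND**: `|(lapF K c m²)⁻¹(x,y)| ≤ ∫_{(0,∞)} e^{−tm²}·Π_μ‖Q^{(K_μ)}_{ct}((x−y)_μ)‖ dt`. [cite: King1986, (2.13) p.653, (4.4) p.670, (4.35) p.674] -/
theorem abs_lapF_inv_le_integral (hc : 0 ≤ c) (hm : 0 < m2) (x y : Tor K) :
    |(lapF K c m2)⁻¹ x y| ≤ ∫ t in Ioi (0 : ℝ), Real.exp (-(t * m2)) * ∏ μ : Fin (d + 1), ‖cycleHeat (K μ) (t * c) ((x - y) μ)‖ := by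
  have h := kingPlaneWave_eq_integral K hc hm x y
  have hn : |(lapF K c m2)⁻¹ x y| = ‖(((lapF K c m2)⁻¹ x y : ℝ) : ℂ)‖ := by rw [Complex.norm_real, Real.norm_eq_abs]
  rw [hn, h]
  refine (norm_integral_le_integral_norm _).trans (le_of_eq ?_)
  refine integral_congr_ae (Filter.Eventually.of_forall fun t => ?_)
  exact norm_heatIntegrand K t (x - y)

/-- Integrability of the mass-weighted product of cycle-kernel norms on `(0,∞)` (`μ > 0`): the majorant PART Ϣ-g integrates. [folklore] -/
theorem integrableOn_heatMajorant {μ0 : ℝ} (hμ : 0 < μ0) (z : Tor K) :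
    IntegrableOn (fun s : ℝ => Real.exp (-(μ0 * s)) * ∏ μ : Fin (d + 1), ‖cycleHeat (K μ) s (z μ)‖) (Ioi 0) := by
  have hmaj : IntegrableOn (fun s : ℝ => Real.exp (-(μ0 * s))) (Ioi 0) := by
    have := exp_neg_integrableOn_Ioi 0 hμ
    exact this.congr_fun (fun t _ => by ring_nf) measurableSet_Ioi
  refine Integrable.mono' hmaj ?_ ?_
  · refine Continuous.aestronglyMeasurable ?_
    refine Continuous.mul (Real.continuous_exp.comp (by fun_prop)) ?_
    exact continuous_finsetProd _ fun μ _ => (continuous_cycleHeat (K := K μ) (z μ)).norm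
  · refine (ae_restrict_iff' measurableSet_Ioi).mpr (Filter.Eventually.of_forall fun s hs => ?_)
    rw [Real.norm_eq_abs, abs_of_nonneg (mul_nonneg (Real.exp_pos _).le (Finset.prod_nonneg fun μ _ => norm_nonneg _))]
    have hprod : ∏ μ : Fin (d + 1), ‖cycleHeat (K μ) s (z μ)‖ ≤ 1 := by
      calc ∏ μ : Fin (d + 1), ‖cycleHeat (K μ) s (z μ)‖ ≤ ∏ _μ : Fin (d + 1), (1 : ℝ) :=
            Finset.prod_le_prod (fun μ _ => norm_nonneg _) (fun μ _ => norm_cycleHeat_le_one (le_of_lt hs) (z μ))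
        _ = 1 := by simp
    calc Real.exp (-(μ0 * s)) * ∏ μ : Fin (d + 1), ‖cycleHeat (K μ) s (z μ)‖ ≤ Real.exp (-(μ0 * s)) * 1 :=
          mul_le_mul_of_nonneg_left hprod (Real.exp_pos _).le
      _ = Real.exp (-(μ0 * s)) := mul_one _

/-- ★★★★ **`c·|G(x,y)| ≤ ∫₀^∞ e^{−(m²∕c)s}·Π_μ‖Q^{(K_μ)}_s((x−y)_μ)‖ds`** (`c > 0`, `m² > 0`, every torus): King's covariance in units of the hopping is dominated by the time integral of
the product of the one-dimensional cycle heat kernels, the MASS entering only through the weight `e^{−(m²∕c)s}` (substitution `s = ct`). At King's scaling `c = L²` this weight is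
`e^{−(m²η²)s}` and every other ingredient of PART Ϣ is mass- and `L`-free. [cite: King1986, (2.13) p.653, (4.4) p.670, (4.35) p.674; Hara2008, §2.1 (2.1)] -/
theorem mul_abs_lapF_inv_le_integral (hc : 0 < c) (hm : 0 < m2) (x y : Tor K) :
    c * |(lapF K c m2)⁻¹ x y| ≤ ∫ s in Ioi (0 : ℝ), Real.exp (-(m2 / c * s)) * ∏ μ : Fin (d + 1), ‖cycleHeat (K μ) s ((x - y) μ)‖ := by
  have h1 := abs_lapF_inv_le_integral K hc.le hm x y
  -- substitution `s = c t`
  set g : ℝ → ℝ := fun s => Real.exp (-(m2 / c * s)) * ∏ μ : Fin (d + 1), ‖cycleHeat (K μ) s ((x - y) μ)‖ with hg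
  have hsub := integral_comp_mul_left_Ioi g 0 hc
  simp only [mul_zero] at hsub
  have hgt : ∀ t : ℝ, g (c * t) = Real.exp (-(t * m2)) * ∏ μ : Fin (d + 1), ‖cycleHeat (K μ) (t * c) ((x - y) μ)‖ := by
    intro t
    simp only [hg]
    rw [show m2 / c * (c * t) = t * m2 by field_simp, mul_comm c t]
  simp_rw [hgt] at hsub
  rw [hsub, smul_eq_mul] at h1
  have hc' : c * (c⁻¹ * ∫ s in Ioi (0 : ℝ), g s) = ∫ s in Ioi (0 : ℝ), g s := by
    rw [← mul_assoc, mul_inv_cancel₀ hc.ne', one_mul]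
  calc c * |(lapF K c m2)⁻¹ x y| ≤ c * (c⁻¹ * ∫ s in Ioi (0 : ℝ), g s) := mul_le_mul_of_nonneg_left h1 hc.le
    _ = ∫ s in Ioi (0 : ℝ), g s := hc'

end Summit.QuantumFields.YangMills.BalabanUVNodes.N15KingModelRung.HeatKernel

end
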